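import Literature.NumberTheory.Sieve.IwaniecBilinearSieveStrips
import Literature.NumberTheory.Sieve.LinearSieveConstant
import HarnessLib

/-!
# Iwaniec's bilinear linear sieve, VI: the main terms of the three levels

Topic `Literature/NumberTheory/Sieve`; sixth support file for the proof of
`Literature.NumberTheory.Sieve.Iwaniec1978.lemma2_bilinearSieve` (H. Iwaniec, *A new form of the error
term in the linear sieve*, Acta Arith. 37 (1980), 307–320, Theorem 1 [IwaniecActaArith1980b]).  The proof in
the tree sieves the primes `< z` in three ranges — tiny primes `< w₁` by the fundamental lemma with
`β = 10` (Greaves), the primes in `[w₁, u)` by Rosser's linear sieve with the explicit Jurkat–Richert main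
term, and the primes in `[u, z)` by the box-truncated weights — so that every error term depends on the
constant `K` of Iwaniec's condition (1) in an explicit way (Iwaniec uses Lemma 3 of the paper, whose `K`-
dependence is not available in the tree).  This file provides the main-term estimates of the first two
levels and the bookkeeping common to all three, all PROVED:

* decay of the linear-sieve functions with an explicit (absolute) constant: `|F(s) − 1|, |f(s) − 1| ≤ C e^{−s}`
  (`exists_linearSieve_decay`, from the normalisation in `IsBetaSieveSolution` and continuity);
* condition (1) implies `Ω(1)` with `K' = 1 + K/log 2` (`hasSieveDimension_of_iwaniec`), the fundamental-
  lemma bound `|∑ μ χ_{10} g − V| ≤ 2K'^{10} e^{10−s} V` for the tiny primes (`abs_mainSum_ten_sub_vprod_le`);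
* the explicit upper/lower main terms for Rosser's weights (`β = 2`) on a range `[w₀, y)` under condition (1)
  with `K/log w₀ ≤ 1/200` (`mainSum_one_Ico_le`, `le_mainSum_zero_Ico`), via `JurkatRichert.restrict`;
* products and sums over ranges: `V(z) = V(y) V(z, y)` (`vprod_primesProdBelow_mul`), and
  `∑_{d ∣ P(b,a)} g(d) ≤ V(b,a)⁻¹ ≤ (log b/log a)(1 + K/log a)` (`sum_divisors_Ico_le`).

## References

* H. Iwaniec, *A new form of the error term in the linear sieve*, Acta Arith. 37 (1980), 307–320, §4 Lemma 4,
  §5. [IwaniecActaArith1980b]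
* G. Greaves, *Sieves in Number Theory*, Springer (2001), §3.3.4 Lemma 6. [Greaves2001]
-/

open Finset Real Filter
open scoped ArithmeticFunction.Moebius

noncomputable section

namespace Literature.NumberTheory.Sieve

namespace Iwaniec1980b

/-! ### Decay of the linear-sieve functions with an absolute constant -/

/-- From `φ − 1 = O(e^{−s})` at infinity and continuity on `(0, ∞)`: an explicit constant on `[a, ∞)`, `a > 0`.
[folklore] -/
theorem exists_const_of_isBigO_of_continuousOn {φ : ℝ → ℝ} (hcont : ContinuousOn φ (Set.Ioi 0))
    (hO : (fun s => φ s - 1) =O[atTop] fun s => Real.exp (-s)) {a : ℝ} (ha : 0 < a) :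
    ∃ C : ℝ, 0 ≤ C ∧ ∀ s, a ≤ s → |φ s - 1| ≤ C * Real.exp (-s) := by
  obtain ⟨C₁, hC₁⟩ := hO.bound
  rw [Filter.eventually_atTop] at hC₁
  obtain ⟨s₁, hs₁⟩ := hC₁
  -- on `[a, max a s₁]` the function is bounded
  set b := max a s₁ with hb
  have hab : a ≤ b := le_max_left _ _
  have hcont' : ContinuousOn (fun s => φ s - 1) (Set.Icc a b) :=
    (hcont.mono fun s hs => lt_of_lt_of_le ha hs.1).sub continuousOn_const
  obtain ⟨B, hB⟩ := (isCompact_Icc (a := a) (b := b)).exists_bound_of_continuousOn hcont'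
  refine ⟨max (max C₁ 0) (max B 0 * Real.exp b), by positivity, fun s hs => ?_⟩
  rcases le_or_gt b s with hbs | hsb
  · have h := hs₁ s ((le_max_right a s₁).trans hbs)
    rw [Real.norm_eq_abs, Real.norm_eq_abs, abs_of_pos (Real.exp_pos _)] at h
    refine h.trans (mul_le_mul_of_nonneg_right ?_ (Real.exp_pos _).le)
    exact (le_max_left _ _).trans (le_max_left _ _)
  · have h := hB s ⟨hs, hsb.le⟩
    rw [Real.norm_eq_abs] at h
    have h2 : B ≤ max B 0 * Real.exp b * Real.exp (-s) := by
      rw [mul_assoc, ← Real.exp_add]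
      have : 1 ≤ Real.exp (b + -s) := Real.one_le_exp (by linarith)
      have hB0 : B ≤ max B 0 := le_max_left _ _
      nlinarith [le_max_right B 0]
    refine (h.trans h2).trans (mul_le_mul_of_nonneg_right (le_max_right _ _) (Real.exp_pos _).le)

/-- **Decay of the linear-sieve functions**: an absolute constant `C ≥ 0` with
`|F(s) − 1| ≤ C e^{−s}` for `s ≥ 1` and `|f(s) − 1| ≤ C e^{−s}` for `s ≥ 2`, `F = upperSieveFun 1`,
`f = lowerSieveFun 1`. [cite: IwaniecActaArith1980b, p. 308 ("F(s), f(s) monotonically converge to 1") and §4 p. 314] -/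
theorem exists_linearSieve_decay :
    ∃ C : ℝ, 0 ≤ C ∧ (∀ s, 1 ≤ s → |upperSieveFun 1 s - 1| ≤ C * Real.exp (-s)) ∧
      (∀ s, 2 ≤ s → |lowerSieveFun 1 s - 1| ≤ C * Real.exp (-s)) := by
  have h := isBetaSieveSolution_upperSieveFun_one
  obtain ⟨C₁, hC₁0, hC₁⟩ := exists_const_of_isBigO_of_continuousOn h.continuousOn_upper h.upper_isBigO one_pos
  obtain ⟨C₂, hC₂0, hC₂⟩ := exists_const_of_isBigO_of_continuousOn h.continuousOn_lower h.lower_isBigO two_pos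
  refine ⟨max C₁ C₂, le_max_of_le_left hC₁0, fun s hs => (hC₁ s hs).trans ?_, fun s hs => (hC₂ s hs).trans ?_⟩
  · exact mul_le_mul_of_nonneg_right (le_max_left _ _) (Real.exp_pos _).le
  · exact mul_le_mul_of_nonneg_right (le_max_right _ _) (Real.exp_pos _).le

/-! ### Condition (1) and the fundamental lemma for the tiny primes -/

variable {g : ArithmeticFunction ℝ} {K : ℝ}

/-- **Condition (1) implies `Ω(1)` with the flat constant `1 + K/log 2`.** [cite: IwaniecActaArith1980b, (1) p. 308] -/
theorem hasSieveDimension_of_iwaniec (hK : 0 ≤ K)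
    (h1 : ∀ w z : ℝ, 2 ≤ w → w < z →
      ∏ p ∈ (Nat.primesBelow ⌈z⌉₊).filter (fun p : ℕ => w ≤ (p : ℝ)), (1 - g p)⁻¹ ≤
        Real.log z / Real.log w * (1 + K / Real.log w))
    (h01 : ∀ p : ℕ, p.Prime → 0 ≤ g p ∧ g p < 1) :
    HasSieveDimension g 1 (1 + K / Real.log 2) := by
  refine ⟨h01, fun w z hw hwz => ?_⟩
  have hlog2 : 0 < Real.log 2 := Real.log_pos one_lt_two
  have hlogw : Real.log 2 ≤ Real.log w := Real.log_le_log two_pos hw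
  have hlogw0 : 0 < Real.log w := lt_of_lt_of_le hlog2 hlogw
  have hK' : 1 ≤ 1 + K / Real.log 2 := by have := div_nonneg hK hlog2.le; linarith
  rcases hwz.eq_or_lt with rfl | hlt
  · have hempty : (Nat.primesBelow ⌈w⌉₊).filter (fun p : ℕ => w ≤ (p : ℝ)) = ∅ := by
      refine Finset.filter_false_of_mem fun p hp => ?_
      rw [Nat.mem_primesBelow] at hp
      exact not_le.mpr (Nat.lt_ceil.mp hp.1)
    rw [hempty, Finset.prod_empty, Real.rpow_one, div_self hlogw0.ne', mul_one]
    exact hK'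
  · refine (h1 w z hw hlt).trans ?_
    rw [Real.rpow_one, mul_comm]
    refine mul_le_mul_of_nonneg_right ?_ (div_nonneg (Real.log_nonneg (by linarith)) hlogw0.le)
    have := div_le_div_of_nonneg_left hK hlog2 hlogw
    linarith

/-- **The fundamental lemma for the tiny primes** (Rosser's weights with `β = 10`, level `ℓ`, sifting the
primes `< y`, `s = log ℓ/log y ≥ 10`): `|∑_{d ∣ P(y)} μ(d) χ_{10}(d) g(d) − V(y)| ≤ 2 K'^{10} e^{10 − s} V(y)`
under `Ω(1)` with constant `K'`. [cite: Greaves2001, §3.3.4 Lemma 6] -/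
theorem abs_mainSum_ten_sub_vprod_le (hg : g.IsMultiplicative) {K' : ℝ} (hdim : HasSieveDimension g 1 K')
    {y ℓ : ℝ} (hy : 2 ≤ y) (hℓ : 1 < ℓ) (hyℓ : 10 * Real.log y ≤ Real.log ℓ) (par : ℕ) :
    |BetaSieve.mainSum par g 10 ℓ (primesProdBelow y) - BetaSieve.vprod g (primesProdBelow y)| ≤
      2 * K' ^ (10 : ℕ) * Real.exp (10 - Real.log ℓ / Real.log y) * BetaSieve.vprod g (primesProdBelow y) := by
  set P := primesProdBelow y with hP
  have hPsq : Squarefree P := squarefree_primesProdBelow y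
  have h01 : ∀ p ∈ P.primeFactors, 0 ≤ g p ∧ g p ≤ 1 := fun p hp =>
    ⟨(hdim.1 p (Nat.prime_of_mem_primeFactors hp)).1, (hdim.1 p (Nat.prime_of_mem_primeFactors hp)).2.le⟩
  have hg0 : ∀ t ∈ P.divisors, 0 ≤ g t := by
    intro t ht
    have htsq := hPsq.squarefree_of_dvd (Nat.dvd_of_mem_divisors ht)
    rw [← Nat.prod_primeFactors_of_squarefree htsq, hg.map_prod_of_subset_primeFactors _ _ Finset.Subset.rfl]
    exact Finset.prod_nonneg fun p hp => (hdim.1 p (Nat.prime_of_mem_primeFactors hp)).1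
  have h1 := BetaSieve.abs_mainTerm_sub_le (par := par) (β := 10) (D := ℓ) hg hPsq hg0 (BetaSieve.vlt_nonneg h01)
  rw [BetaSieve.mainSum]
  refine h1.trans ?_
  have h2 := BetaSieve.bdry_sum_le (par := par) (β := 10) (D := ℓ) hg hdim one_pos hy hℓ (by norm_num) hyℓ
  exact h2

/-! ### Rosser's linear sieve on a range `[w₀, y)` with the explicit main term -/

/-- `V` of the restricted density over `P(y)` is `V` over the range itself. [folklore] -/
theorem vprod_restrict_primesProdIco (w₀ y : ℝ) :
    BetaSieve.vprod (JurkatRichert.restrict g (primesProdIco w₀ y)) (primesProdBelow y) =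
      BetaSieve.vprod g (primesProdIco w₀ y) := by
  rw [JurkatRichert.vprod_restrict_primesProdBelow (primesProdIco_ne_zero w₀ y), BetaSieve.vprod]
  refine Finset.prod_congr ?_ fun _ _ => rfl
  refine Finset.filter_true_of_mem fun p hp => ?_
  exact ((dvd_primesProdIco_iff (Nat.prime_of_mem_primeFactors hp) w₀ y).mp (Nat.dvd_of_mem_primeFactors hp)).2

/-- **Explicit upper main term on a range** `[w₀, y)` (`2 ≤ w₀`, `y ≤ ℓ`, `K/log w₀ ≤ 1/200`): under
condition (1), `∑_{d ∣ P(y,w₀)} μ(d) χ⁺_ℓ(d) g(d) ≤ V(y, w₀) (F(s) + (K/log w₀) e^{14−s})`, `s = log ℓ/log y`.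
[cite: IwaniecActaArith1980b, Lemma 3 (12) p. 313] -/
theorem mainSum_one_Ico_le (hg : g.IsMultiplicative) (hK : 0 ≤ K)
    (h1 : ∀ w z : ℝ, 2 ≤ w → w < z →
      ∏ p ∈ (Nat.primesBelow ⌈z⌉₊).filter (fun p : ℕ => w ≤ (p : ℝ)), (1 - g p)⁻¹ ≤
        Real.log z / Real.log w * (1 + K / Real.log w))
    (h01 : ∀ p : ℕ, p.Prime → 0 ≤ g p ∧ g p < 1) {w₀ y ℓ : ℝ} (hw₀ : 2 ≤ w₀) (hy : 2 ≤ y) (hyℓ : y ≤ ℓ)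
    (hKw : K / Real.log w₀ ≤ 1 / 200) :
    BetaSieve.mainSum 1 g 2 ℓ (primesProdIco w₀ y) ≤
      BetaSieve.vprod g (primesProdIco w₀ y) *
        (upperSieveFun 1 (Real.log ℓ / Real.log y) + K / Real.log w₀ * Real.exp (14 - Real.log ℓ / Real.log y)) := by
  set P₁ := primesProdIco w₀ y with hP₁
  have hP₁0 : P₁ ≠ 0 := primesProdIco_ne_zero w₀ y
  have hdvd : P₁ ∣ primesProdBelow y := primesProdIco_dvd_primesProdBelow w₀ y
  rw [← JurkatRichert.mainSum_restrict (g := g) hdvd 1 2 ℓ, ← vprod_restrict_primesProdIco w₀ y]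
  have hKC := JurkatRichert.kCond_restrict_of_iwaniec (g := g) hK h1 h01 hw₀ hP₁0
    (fun p hp => le_of_mem_primeFactors_primesProdIco hp) y
  have hK1 : (1:ℝ) ≤ 1 + K / Real.log w₀ := by
    have := div_nonneg hK (Real.log_pos (by linarith : (1:ℝ) < w₀)).le; linarith
  have hK2 : 1 + K / Real.log w₀ ≤ 201 / 200 := by linarith
  have h01' := JurkatRichert.restrict_prime (g := g) hP₁0
    (fun p hp => h01 p (Nat.prime_of_mem_primeFactors hp)) y
  have h := JurkatRichert.mainSum_one_le_upperSieveFun (JurkatRichert.isMultiplicative_restrict hg P₁) hK1 hK2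
    hKC h01' hy hyℓ
  rwa [show 1 + K / Real.log w₀ - 1 = K / Real.log w₀ by ring] at h

/-- **Explicit lower main term on a range** `[w₀, y)` (`2 ≤ w₀`, `y² ≤ ℓ`, `K/log w₀ ≤ 1/200`): under
condition (1), `∑_{d ∣ P(y,w₀)} μ(d) χ⁻_ℓ(d) g(d) ≥ V(y, w₀) (f(s) − (K/log w₀) e^{14−s})`, `s = log ℓ/log y`.
[cite: IwaniecActaArith1980b, Lemma 3 (13) p. 313] -/
theorem le_mainSum_zero_Ico (hg : g.IsMultiplicative) (hK : 0 ≤ K)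
    (h1 : ∀ w z : ℝ, 2 ≤ w → w < z →
      ∏ p ∈ (Nat.primesBelow ⌈z⌉₊).filter (fun p : ℕ => w ≤ (p : ℝ)), (1 - g p)⁻¹ ≤
        Real.log z / Real.log w * (1 + K / Real.log w))
    (h01 : ∀ p : ℕ, p.Prime → 0 ≤ g p ∧ g p < 1) {w₀ y ℓ : ℝ} (hw₀ : 2 ≤ w₀) (hy : 2 ≤ y) (hyℓ : y ^ 2 ≤ ℓ)
    (hKw : K / Real.log w₀ ≤ 1 / 200) :
    BetaSieve.vprod g (primesProdIco w₀ y) *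
        (lowerSieveFun 1 (Real.log ℓ / Real.log y) - K / Real.log w₀ * Real.exp (14 - Real.log ℓ / Real.log y)) ≤
      BetaSieve.mainSum 0 g 2 ℓ (primesProdIco w₀ y) := by
  set P₁ := primesProdIco w₀ y with hP₁
  have hP₁0 : P₁ ≠ 0 := primesProdIco_ne_zero w₀ y
  have hdvd : P₁ ∣ primesProdBelow y := primesProdIco_dvd_primesProdBelow w₀ y
  rw [← JurkatRichert.mainSum_restrict (g := g) hdvd 0 2 ℓ, ← vprod_restrict_primesProdIco w₀ y]
  have hKC := JurkatRichert.kCond_restrict_of_iwaniec (g := g) hK h1 h01 hw₀ hP₁0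
    (fun p hp => le_of_mem_primeFactors_primesProdIco hp) y
  have hK1 : (1:ℝ) ≤ 1 + K / Real.log w₀ := by
    have := div_nonneg hK (Real.log_pos (by linarith : (1:ℝ) < w₀)).le; linarith
  have hK2 : 1 + K / Real.log w₀ ≤ 201 / 200 := by linarith
  have h01' := JurkatRichert.restrict_prime (g := g) hP₁0
    (fun p hp => h01 p (Nat.prime_of_mem_primeFactors hp)) y
  have h := JurkatRichert.mainSum_zero_ge (JurkatRichert.isMultiplicative_restrict hg P₁) hK1 hK2
    hKC h01' hy hyℓ
  rwa [show 1 + K / Real.log w₀ - 1 = K / Real.log w₀ by ring] at h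

/-! ### Products and sums over ranges -/

/-- `V` is multiplicative over coprime moduli. [folklore] -/
theorem vprod_mul_of_coprime {m n : ℕ} (hmn : Nat.Coprime m n) :
    BetaSieve.vprod g (m * n) = BetaSieve.vprod g m * BetaSieve.vprod g n := by
  rw [BetaSieve.vprod, BetaSieve.vprod, BetaSieve.vprod, hmn.primeFactors_mul,
    Finset.prod_union hmn.disjoint_primeFactors]

/-- `V(z) = V(y) · V(z, y)` for `y ≤ z`. [folklore] -/
theorem vprod_primesProdBelow_mul {y z : ℝ} (hyz : y ≤ z) :
    BetaSieve.vprod g (primesProdBelow z) =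
      BetaSieve.vprod g (primesProdBelow y) * BetaSieve.vprod g (primesProdIco y z) := by
  rw [← primesProdBelow_mul_primesProdIco hyz, vprod_mul_of_coprime (coprime_primesProdBelow_primesProdIco y z)]

/-- `0 < V` over any modulus when `g(p) < 1` at its primes. [folklore] -/
theorem vprod_pos_of_lt_one {P : ℕ} (h : ∀ p ∈ P.primeFactors, g p < 1) : 0 < BetaSieve.vprod g P :=
  Finset.prod_pos fun p hp => by linarith [h p hp]

/-- **The sum over the divisors of a range and its size** (p. 319: `∑_{q ∣ P(z,u)} ω(q)/q ≤ V(u)/V(z)`):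
`∑_{d ∣ P(b,a)} g(d) ≤ V(b,a)⁻¹`, and under condition (1), `V(b,a)⁻¹ ≤ (log b/log a)(1 + K/log a)` for
`2 ≤ a < b`. [cite: IwaniecActaArith1980b, §5 p. 319] -/
theorem sum_divisors_Ico_le (hg : g.IsMultiplicative) (h01 : ∀ p : ℕ, p.Prime → 0 ≤ g p ∧ g p < 1)
    (a b : ℝ) : ∑ d ∈ (primesProdIco a b).divisors, g d ≤ (BetaSieve.vprod g (primesProdIco a b))⁻¹ :=
  BetaSieve.sum_divisors_le_vprod_inv hg (squarefree_primesProdIco a b)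
    fun p hp => h01 p (Nat.prime_of_mem_primeFactors hp)

/-- `V(b,a)⁻¹ ≤ (log b/log a)(1 + K/log a)` for `2 ≤ a < b` under condition (1). [cite: IwaniecActaArith1980b, (1) p. 308] -/
theorem inv_vprod_Ico_le
    (h1 : ∀ w z : ℝ, 2 ≤ w → w < z →
      ∏ p ∈ (Nat.primesBelow ⌈z⌉₊).filter (fun p : ℕ => w ≤ (p : ℝ)), (1 - g p)⁻¹ ≤
        Real.log z / Real.log w * (1 + K / Real.log w))
    {a b : ℝ} (ha : 2 ≤ a) (hab : a < b) :
    (BetaSieve.vprod g (primesProdIco a b))⁻¹ ≤ Real.log b / Real.log a * (1 + K / Real.log a) := by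
  rw [BetaSieve.vprod, primeFactors_primesProdIco, ← Finset.prod_inv_distrib]
  exact h1 a b ha hab

/-- `V(b,a)⁻¹ ≥ 1` (i.e. `V(b,a) ≤ 1`). [folklore] -/
theorem vprod_Ico_le_one (h01 : ∀ p : ℕ, p.Prime → 0 ≤ g p ∧ g p < 1) (a b : ℝ) :
    BetaSieve.vprod g (primesProdIco a b) ≤ 1 :=
  Finset.prod_le_one (fun p hp => by linarith [(h01 p (Nat.prime_of_mem_primeFactors hp)).2])
    fun p hp => by linarith [(h01 p (Nat.prime_of_mem_primeFactors hp)).1]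

end Iwaniec1980b

end Literature.NumberTheory.Sieve

end
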